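import Mathlib
import HarnessLib

/-!
# Route `QuadraticBranchSignedControl` (rung K8, cell `bsd-potss`), residual crux `PlusEtaMainConjectureNonsurj`
# (stmt-BirchSwinnertonDyer-19606): the ALGEBRAIC CORE of the layer-1 criterion for Coates–Sujatha's (A) — in
# characteristic `p`, the norm element of a cyclic group of order `p` kills every module of dimension `< p`
# (seat k8eta-c2 g7)

WHAT. FINDING-19606-k8eta-c2-g7 §3 proves: (A)(W,p) ⟸ `dim_𝔽ₚ Sel_p(W/ℚ₁) ≤ p − 1` (ℚ₁ the first layer of the
cyclotomic `ℤ_p`-tower), by Deo–Ray–Sujatha 2023 Lemma 3.6 + Hochschild–Serre + Nakayama + the Poitou–Tate `res`/`cor`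
adjunction + ONE piece of linear algebra: for `Δ = Gal(ℚ₁/ℚ) ≅ ℤ/p` acting on the `𝔽ₚ`-space `B = Sel_p(W/ℚ₁)`, the norm
`N_Δ = Σ_{i<p} σ^i` is ZERO on `B` as soon as `dim B ≤ p − 1` — because `N_Δ = (σ − 1)^{p−1}` in `𝔽ₚ[Δ]` and `σ − 1` is
nilpotent of index `≤ dim B`. THIS FILE proves exactly that piece, over any field of characteristic `p`
(`sum_pow_eq_zero_of_pow_eq_one_of_finrank_lt`), with its two polynomial identities. The Galois-cohomological envelope
(G_S-cohomology over `ℚ_cyc`) is not in the tree; this lemma is the part a future typing of the layer-1 road will need.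

HONEST FRAMING: pure linear algebra (Mathlib only); no definition, no named fact, no `sorry`, axioms standard; proves no
stub; nothing booked. `--supports stmt-BirchSwinnertonDyer-19606`.

References: [DeoRaySujatha2023] Lemma 3.6, Thm. 3.7; [Washington1997] §13.3 (norm and augmentation in `ℤ_p[ℤ/p]`).
-/

set_option autoImplicit false
set_option linter.dupNamespace false

namespace Summit.BirchSwinnertonDyer.BirchSwinnertonDyer.Theorems

namespace EtaFineRoad

open Polynomial

variable {K : Type*} [Field K] {p : ℕ} [Fact p.Prime] [CharP K p]

/-- In `K[X]` with `char K = p`: `Σ_{i<p} X^i = (X − 1)^{p−1}` (both times `X − 1` give `X^p − 1 = (X − 1)^p`).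
[cite: Washington1997, §13.3] -/
theorem geom_sum_X_eq_X_sub_one_pow :
    (∑ i ∈ Finset.range p, (X : K[X]) ^ i) = (X - 1) ^ (p - 1) := by
  have hp : p.Prime := Fact.out
  have hX1 : (X : K[X]) - 1 ≠ 0 := X_sub_C_ne_zero 1
  apply mul_right_cancel₀ hX1
  rw [geom_sum_mul, ← pow_succ, Nat.sub_add_cancel hp.one_lt.le, sub_pow_char (X : K[X]) 1, one_pow]

omit [Fact p.Prime] [CharP K p] in
/-- A nilpotent endomorphism `N` with `N^p = 0` of a space of dimension `< p` satisfies `N^{p−1} = 0` (its minimal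
polynomial is `X^k` with `k ≤ dim`). [folklore] -/
theorem pow_pred_eq_zero_of_pow_eq_zero_of_finrank_lt {V : Type*} [AddCommGroup V] [Module K V]
    [FiniteDimensional K V] (N : Module.End K V) (hN : N ^ p = 0) (hdim : Module.finrank K V < p) :
    N ^ (p - 1) = 0 := by
  have hint : IsIntegral K N := Algebra.IsIntegral.isIntegral N
  have hdvd : minpoly K N ∣ (X : K[X]) ^ p := minpoly.dvd K N (by simp [hN])
  obtain ⟨k, hkp, hassoc⟩ := (dvd_prime_pow Polynomial.prime_X p).mp hdvd
  have hmin : minpoly K N = X ^ k :=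
    eq_of_monic_of_associated (minpoly.monic hint) (monic_X_pow k) hassoc
  have hk : k ≤ Module.finrank K V := by
    have h1 : minpoly K N ∣ N.charpoly := LinearMap.minpoly_dvd_charpoly N
    have h2 := Polynomial.natDegree_le_of_dvd h1 (LinearMap.charpoly_monic N).ne_zero
    rw [hmin, natDegree_X_pow, LinearMap.charpoly_natDegree] at h2
    exact h2
  have hNk : N ^ k = 0 := by
    have h := minpoly.aeval K N
    rwa [hmin, aeval_X_pow] at h
  have hle : k ≤ p - 1 := by omega
  rw [← Nat.sub_add_cancel hle, pow_add, hNk, mul_zero]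

/-- **The norm of `ℤ/p` kills an `𝔽ₚ`-representation of dimension `< p`.** Over a field `K` of characteristic `p`, for an
endomorphism `σ` of a finite-dimensional space `V` with `σ^p = 1` and `dim V < p`: `Σ_{i<p} σ^i = 0`. Proof: `N = σ − 1`
satisfies `N^p = σ^p − 1 = 0` (binomial theorem in characteristic `p`, through `K[X]`), hence `N^{p−1} = 0`
(`pow_pred_eq_zero_of_pow_eq_zero_of_finrank_lt`), and `Σ σ^i = (σ − 1)^{p−1}`. This is the step «`dim_𝔽ₚ Sel_p(W/ℚ₁) ≤ p − 1`
⟹ the norm `cor ∘ res` vanishes» of the layer-1 criterion for statement (A) (FINDING-19606-k8eta-c2-g7 §3.2).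
[cite: Washington1997, §13.3] [cite: DeoRaySujatha2023, Lemma 3.6] -/
theorem sum_pow_eq_zero_of_pow_eq_one_of_finrank_lt {V : Type*} [AddCommGroup V] [Module K V]
    [FiniteDimensional K V] (σ : Module.End K V) (hσ : σ ^ p = 1) (hdim : Module.finrank K V < p) :
    (∑ i ∈ Finset.range p, σ ^ i) = 0 := by
  have hp : p.Prime := Fact.out
  -- everything through the polynomial functional calculus `aeval σ`
  have hN : aeval σ ((X : K[X]) - 1) = σ - 1 := by simp
  have hNp : (σ - 1) ^ p = 0 := by
    rw [← hN, ← map_pow, sub_pow_char (X : K[X]) 1, one_pow, map_sub, aeval_X_pow, map_one, hσ, sub_self]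
  have hNp1 : (σ - 1) ^ (p - 1) = 0 := pow_pred_eq_zero_of_pow_eq_zero_of_finrank_lt (σ - 1) hNp hdim
  calc (∑ i ∈ Finset.range p, σ ^ i) = aeval σ (∑ i ∈ Finset.range p, (X : K[X]) ^ i) := by
        simp [map_sum]
    _ = aeval σ (((X : K[X]) - 1) ^ (p - 1)) := by rw [geom_sum_X_eq_X_sub_one_pow]
    _ = (σ - 1) ^ (p - 1) := by rw [map_pow, hN]
    _ = 0 := hNp1

end EtaFineRoad

end Summit.BirchSwinnertonDyer.BirchSwinnertonDyer.Theorems
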